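import Literature.NumberTheory.AdelicBaseChange.AdicCompletionDensity          -- ★ `adicCompletion.exists_uniformizer`, `mem_completionIdeal_pow`
import Literature.RingTheory.DiscreteValuationRing.AdicCompletionResidueField   -- ★ `natCard_residueField_adicCompletionIntegers`
import Mathlib.RingTheory.Ideal.Norm.AbsNorm
import Mathlib.GroupTheory.Index
import Mathlib.LinearAlgebra.Matrix.GeneralLinearGroup.Defs
import Mathlib.LinearAlgebra.Matrix.ToLin
import Mathlib.NumberTheory.NumberField.Basic
import HarnessLib

/-!
# The index of one valuation ball lattice in another, in `F_v^n`: `[B(e) : B(e + k)] = q_v^{Σ k}`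
# ([Serre, Local Fields] Ch. II §3 Prop. 5: `[𝔪^i : 𝔪^{i+1}] = q`; [Shimura 1971] §3.2: the `q + 1` neighbours of a lattice)

Topic `NumberTheory/LocalFields`; namespace `Literature.NumberTheory.LocalFields`.  THEOREMS ONLY (no definition, no named fact, no instance, no notation,
no `sorry`).  Cell `hodgecm-mathlib`, half A line L5, X-LEAF socket `stub_EHECKE`, organ (O-L) part 2 = FILE B (DEAL L5-#6, LA5-p02 (g3)), layer (B2-loc):
the LOCAL COUNT behind (L-c) «`[H(g) : Λ_a] = q`» and (L-c′) «`[𝔭_{c•w}⁻¹Λ_a : Λ_a] = q²`» once ★ `LatticeIndexLocalReadout.relIndex_comap_readout_eq` has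
reduced them to indices of valuation-ball lattices in `F_{w̄}²` (FILE A՚s local coordinate `θ`: the frame lattice reads `ϖ^m 𝒪_{w̄}²`).  `--supports
stmt-HodgeConjecture-24832`, count-neutral; HC_CM is proved only modulo the 7 printed citations until rung 0 closes; this file is generic and discharges none.

THE STATEMENT.  `F` a number field, `v` a finite place, `K = F_v` with Mathlib՚s `Valued.v : K → ℤᵐ⁰`, `q = Nat.card (𝓞 F ⧸ v)`.  For exponent vectors
`e : Fin n → ℤ`, `k : Fin n → ℕ` the BALL LATTICES `B(e) = {ℓ : Fin n → K | ∀ j, v(ℓ j) ≤ exp(−e j)}` are additive subgroups (§1, stated as an existence so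
that no definition is introduced), and **`[B(e) : B(e + k)] = q^{Σ_j k j}`** (§2, `AddSubgroup.relIndex`): scale coordinate `j` by `ϖ^{−e j}` (an additive
bijection carrying `B(e) ↦ 𝒪ⁿ`, `B(e+k) ↦ ∏ 𝔪^{k j}`), then `[𝒪ⁿ : ∏ 𝔪^{k j}] = ∏ [𝒪 : 𝔪^{k j}] = ∏ q^{k j}` (Mathlib `AddSubgroup.index_pi`,
`cardQuot_pow_of_prime`, ★ `natCard_residueField_adicCompletionIntegers`).  Instances: `n = 2, k = (1,1)` gives `q²` ((L-c′)); `k = (1,0)` gives `q`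
((L-c), after a `GL₂(𝒪)`-change of frame which preserves `B(m,m)`).

§3 (ED. 2) TRANSLATED BALLS: for `h = k₁·d·k₂` with `k₁, k₂` stabilising `B(m)` and `d = diag(c)`, `v(c j) = exp(e j) ≥ 1`:
`forall_valued_inv_mulVec_le_of_normalForm` (`h⁻¹B(m) ⊆ B(m)`), `forall_valued_mulVec_le_of_normalForm` (`hB(m) ⊆ B(m − E)`, `e ≤ E`), and
**`relIndex_ball_normalForm_eq_pow` — `[hB(m) : B(m)] = q^{Σ e}`** (`= q` for the Hecke matrix `diag(ϖ⁻¹,1)`, `e = (1,0)`).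

## References
* [Serre1979] J.-P. Serre, *Local Fields* (1979), Ch. II §3 Prop. 5.
* [ShimuraIATAF1971] G. Shimura, *Introduction to the Arithmetic Theory of Automorphic Functions* (1971), §3.2 (Lemma 3.22–3.23).
* [CasselsFrohlichANT1967] J. W. S. Cassels, A. Fröhlich (eds.), *Algebraic Number Theory* (1967), Ch. II §7 (local fields: `[𝒪 : 𝔭^k] = q^k`).

#harness_tags number_theory.local_fields, linear_algebra.lattices
-/

set_option autoImplicit false

noncomputable section

open IsDedekindDomain NumberField

namespace Literature.NumberTheory.LocalFields

variable (F : Type) [Field F] [NumberField F] (v : HeightOneSpectrum (𝓞 F))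

/-! ### §1 Ball lattices are additive subgroups -/

/-- **The ball lattice `B(e) = {ℓ | ∀ j, v(ℓ j) ≤ exp(−e j)}` is an additive subgroup of `F_v^n`** (ultrametric inequality).  Stated as an existence (no
definition is introduced); any two subgroups with this membership are equal by extensionality. [cite: Serre1979, Ch. II §3 Prop. 5]
[cite: CasselsFrohlichANT1967, Ch. II §7] -/
theorem exists_addSubgroup_ball {n : ℕ} (e : Fin n → ℤ) :
    ∃ B : AddSubgroup (Fin n → v.adicCompletion F), ∀ ℓ, ℓ ∈ B ↔ ∀ j, Valued.v (ℓ j) ≤ WithZero.exp (-(e j)) := by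
  refine ⟨{ carrier := {ℓ | ∀ j, Valued.v (ℓ j) ≤ WithZero.exp (-(e j))}
            add_mem' := fun {a b} ha hb j => ?_
            zero_mem' := fun j => by simp
            neg_mem' := fun {a} ha j => by rw [Pi.neg_apply, Valuation.map_neg]; exact ha j }, fun ℓ => Iff.rfl⟩
  rw [Pi.add_apply]
  exact (Valued.v.map_add _ _).trans (max_le (ha j) (hb j))

/-! ### §2 The index `[B(e) : B(e + k)] = q^{Σ k}` -/

/-- A uniformizer power: `v(ϖ^t) = exp(−t)` for `t : ℤ`. [cite: Serre1979, Ch. II §3 Prop. 5] -/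
private theorem exists_valued_zpow :
    ∃ ϖ : v.adicCompletion F, ϖ ≠ 0 ∧ ∀ t : ℤ, Valued.v (ϖ ^ t) = WithZero.exp (-t) := by
  obtain ⟨π, hπ⟩ := HeightOneSpectrum.adicCompletion.exists_uniformizer F v
  have hπ' : Valued.v (π : v.adicCompletion F) = WithZero.exp (-1 : ℤ) := hπ
  have hπ0 : (π : v.adicCompletion F) ≠ 0 := by
    intro h
    rw [h, Valuation.map_zero] at hπ'
    exact WithZero.exp_ne_zero hπ'.symm
  refine ⟨π, hπ0, fun t => ?_⟩
  rw [map_zpow₀, hπ', ← WithZero.exp_zsmul, smul_neg, zsmul_one, Int.cast_id]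

/-- **`[B(e) : B(e + k)] = q^{Σ_j k j}` IN `F_v^n`.**  For ball lattices `B ⊆ B′` with exponents `e + k` and `e` (`k ≥ 0` coordinatewise), the relative index
of `B` in `B′` is `Nat.card (𝓞 F ⧸ v) ^ (∑ j, k j)`. [cite: Serre1979, Ch. II §3 Prop. 5] [cite: ShimuraIATAF1971, §3.2] [cite: CasselsFrohlichANT1967, Ch. II §7] -/
theorem relIndex_ball_eq_pow {n : ℕ} (e : Fin n → ℤ) (k : Fin n → ℕ) (B B' : AddSubgroup (Fin n → v.adicCompletion F))
    (hB : ∀ ℓ, ℓ ∈ B ↔ ∀ j, Valued.v (ℓ j) ≤ WithZero.exp (-(e j + k j)))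
    (hB' : ∀ ℓ, ℓ ∈ B' ↔ ∀ j, Valued.v (ℓ j) ≤ WithZero.exp (-(e j))) :
    B.relIndex B' = Nat.card (𝓞 F ⧸ v.asIdeal) ^ (∑ j, k j) := by
  classical
  obtain ⟨ϖ, hϖ0, hϖ⟩ := exists_valued_zpow F v
  -- Step 1: scale coordinate `j` by `ϖ^{-e j}`: an additive bijection `f` of `F_v^n` with `B = f⁻¹ B₀(k)`, `B′ = f⁻¹ B₀(0)`
  let 𝒪 := v.adicCompletionIntegers F
  let f : (Fin n → v.adicCompletion F) →+ (Fin n → v.adicCompletion F) :=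
    { toFun := fun ℓ j => ϖ ^ (-(e j)) * ℓ j
      map_zero' := by funext j; simp
      map_add' := fun a b => by funext j; simp [mul_add] }
  have hf : Function.Surjective f := fun y => ⟨fun j => ϖ ^ (e j) * y j, by
    funext j
    change ϖ ^ (-(e j)) * (ϖ ^ (e j) * y j) = y j
    rw [← mul_assoc, ← zpow_add₀ hϖ0, neg_add_cancel, zpow_zero, one_mul]⟩
  have hval : ∀ (t : ℤ) (x : v.adicCompletion F) (s : ℤ),
      Valued.v (ϖ ^ (-t) * x) ≤ WithZero.exp (-s) ↔ Valued.v x ≤ WithZero.exp (-(t + s)) := by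
    intro t x s
    rw [map_mul, hϖ, neg_neg]
    constructor
    · intro h
      have h2 := mul_le_mul' (le_refl (WithZero.exp (-t))) h
      rwa [← mul_assoc, ← WithZero.exp_add, neg_add_cancel, WithZero.exp_zero, one_mul, ← WithZero.exp_add,
        show -t + -s = -(t + s) by omega] at h2
    · intro h
      have h2 := mul_le_mul' (le_refl (WithZero.exp t)) h
      rwa [← WithZero.exp_add, show t + -(t + s) = -s by omega] at h2
  -- the ball lattices at exponent `0` and `k`, built from `𝒪` and `𝔪^{k j}`
  let ι : (Fin n → 𝒪) →+ (Fin n → v.adicCompletion F) := (𝒪.toSubring.subtype.toAddMonoidHom).compLeft (Fin n)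
  have hι : Function.Injective ι := fun a b h => by
    funext j
    exact Subtype.ext (congrFun h j)
  let P : AddSubgroup (Fin n → 𝒪) :=
    AddSubgroup.pi Set.univ fun j => ((HeightOneSpectrum.completionIdeal F v) ^ (k j)).toAddSubgroup
  have hmemP : ∀ y : Fin n → v.adicCompletion F,
      y ∈ P.map ι ↔ ∀ j, Valued.v (y j) ≤ WithZero.exp (-(k j : ℤ)) := by
    intro y
    constructor
    · rintro ⟨x, hx, rfl⟩ j
      have hxj := (AddSubgroup.mem_pi Set.univ).1 hx j (Set.mem_univ _)
      rw [Submodule.mem_toAddSubgroup, HeightOneSpectrum.adicCompletion.mem_completionIdeal_pow] at hxj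
      exact hxj
    · intro hy
      have hy1 : ∀ j, Valued.v (y j) ≤ 1 := fun j => (hy j).trans (by
        rw [← WithZero.exp_zero, WithZero.exp_le_exp, neg_nonpos]; exact Int.natCast_nonneg _)
      refine ⟨fun j => ⟨y j, hy1 j⟩, ?_, ?_⟩
      · refine (AddSubgroup.mem_pi Set.univ).2 fun j _ => ?_
        rw [Submodule.mem_toAddSubgroup, HeightOneSpectrum.adicCompletion.mem_completionIdeal_pow]
        exact hy j
      · funext j; rfl
  have hmemT : ∀ y : Fin n → v.adicCompletion F, y ∈ (⊤ : AddSubgroup (Fin n → 𝒪)).map ι ↔ ∀ j, Valued.v (y j) ≤ 1 := by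
    intro y
    constructor
    · rintro ⟨x, -, rfl⟩ j
      exact (x j).2
    · intro hy
      exact ⟨fun j => ⟨y j, hy j⟩, AddSubgroup.mem_top _, funext fun j => rfl⟩
  -- `B = f⁻¹ (ι P)`, `B′ = f⁻¹ (ι ⊤)`
  have hBf : B = (P.map ι).comap f := by
    ext ℓ
    rw [hB, AddSubgroup.mem_comap, hmemP]
    refine forall_congr' fun j => ?_
    change _ ↔ Valued.v (ϖ ^ (-(e j)) * ℓ j) ≤ _
    rw [hval]
  have hB'f : B' = ((⊤ : AddSubgroup (Fin n → 𝒪)).map ι).comap f := by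
    ext ℓ
    rw [hB', AddSubgroup.mem_comap, hmemT]
    refine forall_congr' fun j => ?_
    change _ ↔ Valued.v (ϖ ^ (-(e j)) * ℓ j) ≤ _
    rw [← WithZero.exp_zero, show (0 : ℤ) = -0 from neg_zero.symm, hval, add_zero]
  -- Step 2: indices are invariant under `f` (surjective, so `map f (comap f X) = X`) and under the injective `ι`
  rw [hBf, hB'f, AddSubgroup.relIndex_comap, AddSubgroup.map_comap_eq_self_of_surjective hf,
    AddSubgroup.relIndex_map_map_of_injective _ _ hι, AddSubgroup.relIndex_top_right, AddSubgroup.index_pi]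
  -- Step 3: `[𝒪 : 𝔪^k] = q^k`
  refine (Finset.prod_congr rfl fun j _ => ?_).trans (Finset.prod_pow_eq_pow_sum _ _ _)
  change Submodule.cardQuot ((HeightOneSpectrum.completionIdeal F v) ^ (k j)) = _
  rw [cardQuot_pow_of_prime (HeightOneSpectrum.completionIdeal_ne_bot F v), Submodule.cardQuot_apply]
  congr 1
  exact HeightOneSpectrum.natCard_residueField_adicCompletionIntegers F v

/-! ### §3 (ED. 2) Translated balls `h·B(m)` for `h = k₁·d·k₂` (`k₁, k₂` stabilising balls, `d` diagonal): containments and the index `q^{Σ e}` -/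

section NormalForm

open Matrix

/-- `exp t · x ≤ exp s ↔ x ≤ exp (s − t)` in `ℤₘ₀`. [folklore] -/
private theorem exp_mul_le_exp_iff (t s : ℤ) (x : WithZero (Multiplicative ℤ)) :
    WithZero.exp t * x ≤ WithZero.exp s ↔ x ≤ WithZero.exp (s - t) := by
  constructor
  · intro h
    have h2 := mul_le_mul' (le_refl (WithZero.exp (-t))) h
    rwa [← mul_assoc, ← WithZero.exp_add, neg_add_cancel, WithZero.exp_zero, one_mul, ← WithZero.exp_add,
      show -t + s = s - t by omega] at h2
  · intro h
    have h2 := mul_le_mul' (le_refl (WithZero.exp t)) h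
    rwa [← WithZero.exp_add, show t + (s - t) = s by omega] at h2

/-- `x (x⁻¹ ℓ) = ℓ` for `x ∈ GL_n`. [folklore] -/
private theorem mulVec_inv_mulVec {n : ℕ} (x : GL (Fin n) (v.adicCompletion F)) (ℓ : Fin n → v.adicCompletion F) :
    ((x : GL (Fin n) (v.adicCompletion F)) : Matrix (Fin n) (Fin n) (v.adicCompletion F)) *ᵥ ((((x⁻¹ : GL (Fin n) (v.adicCompletion F)) : Matrix (Fin n) (Fin n) (v.adicCompletion F))) *ᵥ ℓ) = ℓ := by
  rw [Matrix.mulVec_mulVec, ← Units.val_mul, mul_inv_cancel, Units.val_one, Matrix.one_mulVec]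

/-- `x⁻¹ (x ℓ) = ℓ` for `x ∈ GL_n`. [folklore] -/
private theorem inv_mulVec_mulVec {n : ℕ} (x : GL (Fin n) (v.adicCompletion F)) (ℓ : Fin n → v.adicCompletion F) :
    (((x⁻¹ : GL (Fin n) (v.adicCompletion F)) : Matrix (Fin n) (Fin n) (v.adicCompletion F))) *ᵥ (((x : GL (Fin n) (v.adicCompletion F)) : Matrix (Fin n) (Fin n) (v.adicCompletion F)) *ᵥ ℓ) = ℓ := by
  rw [Matrix.mulVec_mulVec, ← Units.val_mul, inv_mul_cancel, Units.val_one, Matrix.one_mulVec]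

/-- A ball stabiliser also stabilises through its inverse: `ℓ ∈ B ↔ k⁻¹ℓ ∈ B`. [cite: ShimuraIATAF1971, §3.2] -/
private theorem forall_valued_inv_mulVec_le_iff {n : ℕ} (m : ℤ) (k : GL (Fin n) (v.adicCompletion F))
    (hk : ∀ ℓ : Fin n → v.adicCompletion F, (∀ j, Valued.v (ℓ j) ≤ WithZero.exp (-m)) ↔
      ∀ j, Valued.v ((((k : GL (Fin n) (v.adicCompletion F)) : Matrix (Fin n) (Fin n) (v.adicCompletion F)) *ᵥ ℓ) j) ≤ WithZero.exp (-m))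
    (ℓ : Fin n → v.adicCompletion F) :
    (∀ j, Valued.v (ℓ j) ≤ WithZero.exp (-m)) ↔ ∀ j, Valued.v (((((k⁻¹ : GL (Fin n) (v.adicCompletion F)) : Matrix (Fin n) (Fin n) (v.adicCompletion F))) *ᵥ ℓ) j) ≤ WithZero.exp (-m) := by
  conv_lhs => rw [← mulVec_inv_mulVec F v k ℓ]
  exact (hk _).symm

/-- **A DIAGONAL MATRIX SHIFTS THE BALL EXPONENTS**: for `d = diag(c)` with `v(c j) = exp(e j)`, `d⁻¹x ∈ B(m,…,m) ↔ x ∈ B(m − e)`.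
[cite: ShimuraIATAF1971, §3.2] [cite: Serre1979, Ch. II §3 Prop. 5] -/
theorem forall_valued_inv_mulVec_le_iff_of_diagonal {n : ℕ} (m : ℤ) (e : Fin n → ℤ) (c : Fin n → v.adicCompletion F) (d : GL (Fin n) (v.adicCompletion F))
    (hd : ((d : GL (Fin n) (v.adicCompletion F)) : Matrix (Fin n) (Fin n) (v.adicCompletion F)) = Matrix.diagonal c) (hc : ∀ j, Valued.v (c j) = WithZero.exp (e j)) (x : Fin n → v.adicCompletion F) :
    (∀ j, Valued.v (((((d⁻¹ : GL (Fin n) (v.adicCompletion F)) : Matrix (Fin n) (Fin n) (v.adicCompletion F))) *ᵥ x) j) ≤ WithZero.exp (-m)) ↔ ∀ j, Valued.v (x j) ≤ WithZero.exp (-(m - e j)) := by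
  have hx : ∀ j, x j = c j * ((((d⁻¹ : GL (Fin n) (v.adicCompletion F)) : Matrix (Fin n) (Fin n) (v.adicCompletion F))) *ᵥ x) j := fun j => by
    conv_lhs => rw [← mulVec_inv_mulVec F v d x, hd, Matrix.mulVec_diagonal]
  refine forall_congr' fun j => ?_
  rw [hx j, map_mul, hc j, exp_mul_le_exp_iff, show -(m - e j) - e j = -m by omega]

/-- **`(k₁ d k₂)⁻¹ B(m) ⊆ B(m)`** for `k₁, k₂` stabilising `B(m)` and `d = diag(c)` with `v(c j) = exp(e j)`, `e j ≥ 0` (the translated ball `k₁ d k₂·B(m)`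
CONTAINS `B(m)`). [cite: ShimuraIATAF1971, §3.2] [cite: Serre1979, Ch. II §3 Prop. 5] -/
theorem forall_valued_inv_mulVec_le_of_normalForm {n : ℕ} (m : ℤ) (e : Fin n → ℕ) (c : Fin n → v.adicCompletion F) (k₁ d k₂ : GL (Fin n) (v.adicCompletion F))
    (hd : ((d : GL (Fin n) (v.adicCompletion F)) : Matrix (Fin n) (Fin n) (v.adicCompletion F)) = Matrix.diagonal c) (hc : ∀ j, Valued.v (c j) = WithZero.exp (e j : ℤ))
    (hk₁ : ∀ ℓ : Fin n → v.adicCompletion F, (∀ j, Valued.v (ℓ j) ≤ WithZero.exp (-m)) ↔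
      ∀ j, Valued.v ((((k₁ : GL (Fin n) (v.adicCompletion F)) : Matrix (Fin n) (Fin n) (v.adicCompletion F)) *ᵥ ℓ) j) ≤ WithZero.exp (-m))
    (hk₂ : ∀ ℓ : Fin n → v.adicCompletion F, (∀ j, Valued.v (ℓ j) ≤ WithZero.exp (-m)) ↔
      ∀ j, Valued.v ((((k₂ : GL (Fin n) (v.adicCompletion F)) : Matrix (Fin n) (Fin n) (v.adicCompletion F)) *ᵥ ℓ) j) ≤ WithZero.exp (-m))
    (ℓ : Fin n → v.adicCompletion F) (hℓ : ∀ j, Valued.v (ℓ j) ≤ WithZero.exp (-m)) :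
    ∀ j, Valued.v ((((((k₁ * d * k₂)⁻¹ : GL (Fin n) (v.adicCompletion F)) : Matrix (Fin n) (Fin n) (v.adicCompletion F))) *ᵥ ℓ) j) ≤ WithZero.exp (-m) := by
  rw [_root_.mul_inv_rev, _root_.mul_inv_rev, Units.val_mul, Units.val_mul, ← Matrix.mulVec_mulVec, ← Matrix.mulVec_mulVec]
  refine (forall_valued_inv_mulVec_le_iff F v m k₂ hk₂ _).1 ?_
  refine (forall_valued_inv_mulVec_le_iff_of_diagonal F v m (fun j => (e j : ℤ)) c d hd hc _).2 fun j => ?_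
  exact (((forall_valued_inv_mulVec_le_iff F v m k₁ hk₁ ℓ).1 hℓ) j).trans (WithZero.exp_le_exp.2 (by omega))

/-- **`(k₁ d k₂) B(m) ⊆ B(m − E)`** for `k₂` stabilising `B(m)`, `k₁` stabilising `B(m − E)`, `d = diag(c)` with `v(c j) = exp(e j)`, `0 ≤ e j ≤ E`.
[cite: ShimuraIATAF1971, §3.2] [cite: Serre1979, Ch. II §3 Prop. 5] -/
theorem forall_valued_mulVec_le_of_normalForm {n : ℕ} (m : ℤ) (e : Fin n → ℕ) (E : ℕ) (hE : ∀ j, e j ≤ E) (c : Fin n → v.adicCompletion F)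
    (k₁ d k₂ : GL (Fin n) (v.adicCompletion F))
    (hd : ((d : GL (Fin n) (v.adicCompletion F)) : Matrix (Fin n) (Fin n) (v.adicCompletion F)) = Matrix.diagonal c) (hc : ∀ j, Valued.v (c j) = WithZero.exp (e j : ℤ))
    (hk₁ : ∀ ℓ : Fin n → v.adicCompletion F, (∀ j, Valued.v (ℓ j) ≤ WithZero.exp (-(m - E))) ↔
      ∀ j, Valued.v ((((k₁ : GL (Fin n) (v.adicCompletion F)) : Matrix (Fin n) (Fin n) (v.adicCompletion F)) *ᵥ ℓ) j) ≤ WithZero.exp (-(m - E)))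
    (hk₂ : ∀ ℓ : Fin n → v.adicCompletion F, (∀ j, Valued.v (ℓ j) ≤ WithZero.exp (-m)) ↔
      ∀ j, Valued.v ((((k₂ : GL (Fin n) (v.adicCompletion F)) : Matrix (Fin n) (Fin n) (v.adicCompletion F)) *ᵥ ℓ) j) ≤ WithZero.exp (-m))
    (ℓ : Fin n → v.adicCompletion F) (hℓ : ∀ j, Valued.v (ℓ j) ≤ WithZero.exp (-m)) :
    ∀ j, Valued.v (((((k₁ * d * k₂ : GL (Fin n) (v.adicCompletion F))) : Matrix (Fin n) (Fin n) (v.adicCompletion F)) *ᵥ ℓ) j) ≤ WithZero.exp (-(m - E)) := by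
  rw [Units.val_mul, Units.val_mul, ← Matrix.mulVec_mulVec, ← Matrix.mulVec_mulVec]
  refine (hk₁ _).1 fun j => ?_
  rw [hd, Matrix.mulVec_diagonal, map_mul, hc j, exp_mul_le_exp_iff]
  exact (((hk₂ ℓ).1 hℓ) j).trans (WithZero.exp_le_exp.2 (by have := hE j; omega))

/-- **INDEX OF A TRANSLATED BALL: `[k₁ d k₂ · B(m) : B(m)] = q^{Σ_j e j}`** for `k₁, k₂` stabilising `B(m) = B(m,…,m)` and `d = diag(c)`, `v(c j) = exp(e j)`,
`e j ≥ 0`: pulling back along the additive automorphism `k₁⁻¹` gives `[B(m − e) : B(m)]` (§2).  For `n = 2`, `e = (1, 0)` (the Hecke matrix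
`diag(ϖ⁻¹, 1)` up to `GL₂(𝒪)` on both sides) the index is `q`. [cite: ShimuraIATAF1971, §3.2 Lemma 3.22–3.23] [cite: Serre1979, Ch. II §3 Prop. 5]
[cite: CasselsFrohlichANT1967, Ch. II §7] -/
theorem relIndex_ball_normalForm_eq_pow {n : ℕ} (m : ℤ) (e : Fin n → ℕ) (c : Fin n → v.adicCompletion F) (k₁ d k₂ : GL (Fin n) (v.adicCompletion F))
    (hd : ((d : GL (Fin n) (v.adicCompletion F)) : Matrix (Fin n) (Fin n) (v.adicCompletion F)) = Matrix.diagonal c) (hc : ∀ j, Valued.v (c j) = WithZero.exp (e j : ℤ))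
    (hk₁ : ∀ ℓ : Fin n → v.adicCompletion F, (∀ j, Valued.v (ℓ j) ≤ WithZero.exp (-m)) ↔
      ∀ j, Valued.v ((((k₁ : GL (Fin n) (v.adicCompletion F)) : Matrix (Fin n) (Fin n) (v.adicCompletion F)) *ᵥ ℓ) j) ≤ WithZero.exp (-m))
    (hk₂ : ∀ ℓ : Fin n → v.adicCompletion F, (∀ j, Valued.v (ℓ j) ≤ WithZero.exp (-m)) ↔
      ∀ j, Valued.v ((((k₂ : GL (Fin n) (v.adicCompletion F)) : Matrix (Fin n) (Fin n) (v.adicCompletion F)) *ᵥ ℓ) j) ≤ WithZero.exp (-m))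
    (B L : AddSubgroup (Fin n → v.adicCompletion F)) (hB : ∀ ℓ, ℓ ∈ B ↔ ∀ j, Valued.v (ℓ j) ≤ WithZero.exp (-m))
    (hL : ∀ ℓ, ℓ ∈ L ↔ ∀ j, Valued.v ((((((k₁ * d * k₂)⁻¹ : GL (Fin n) (v.adicCompletion F)) : Matrix (Fin n) (Fin n) (v.adicCompletion F))) *ᵥ ℓ) j) ≤ WithZero.exp (-m)) :
    B.relIndex L = Nat.card (𝓞 F ⧸ v.asIdeal) ^ (∑ j, e j) := by
  -- the pull-back map `f = k₁⁻¹ •` (a surjective additive endomorphism of `F_vⁿ`)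
  let f : (Fin n → v.adicCompletion F) →+ (Fin n → v.adicCompletion F) := (Matrix.mulVecLin (((k₁⁻¹ : GL (Fin n) (v.adicCompletion F)) : Matrix (Fin n) (Fin n) (v.adicCompletion F)))).toAddMonoidHom
  have hf : ∀ ℓ, f ℓ = (((k₁⁻¹ : GL (Fin n) (v.adicCompletion F)) : Matrix (Fin n) (Fin n) (v.adicCompletion F))) *ᵥ ℓ := fun _ => rfl
  have hfs : Function.Surjective f := fun y => ⟨((k₁ : GL (Fin n) (v.adicCompletion F)) : Matrix (Fin n) (Fin n) (v.adicCompletion F)) *ᵥ y, by rw [hf, inv_mulVec_mulVec]⟩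
  -- the shifted ball `B′ = B(m − e)`
  obtain ⟨B', hB'⟩ := exists_addSubgroup_ball F v (fun j => m - (e j : ℤ))
  have hB'' : ∀ ℓ, ℓ ∈ B' ↔ ∀ j, Valued.v (ℓ j) ≤ WithZero.exp (-(m - (e j : ℤ))) := hB'
  have hLf : L = B'.comap f := by
    ext ℓ
    rw [hL, AddSubgroup.mem_comap, hB'', hf, _root_.mul_inv_rev, _root_.mul_inv_rev, Units.val_mul, Units.val_mul, ← Matrix.mulVec_mulVec,
      ← Matrix.mulVec_mulVec, ← forall_valued_inv_mulVec_le_iff F v m k₂ hk₂,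
      forall_valued_inv_mulVec_le_iff_of_diagonal F v m (fun j => (e j : ℤ)) c d hd hc]
  have hBf : B = B.comap f := by
    ext ℓ
    rw [AddSubgroup.mem_comap, hB, hB, hf]
    exact forall_valued_inv_mulVec_le_iff F v m k₁ hk₁ ℓ
  have hBk : ∀ ℓ, ℓ ∈ B ↔ ∀ j, Valued.v (ℓ j) ≤ WithZero.exp (-((fun j => m - (e j : ℤ)) j + (e j : ℤ))) := fun ℓ => by
    simp only [sub_add_cancel]; exact hB ℓ
  rw [hLf, hBf, AddSubgroup.relIndex_comap, AddSubgroup.map_comap_eq_self_of_surjective hfs]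
  exact relIndex_ball_eq_pow F v (fun j => m - (e j : ℤ)) e B B' hBk hB'

end NormalForm

end Literature.NumberTheory.LocalFields

end
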